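import Summits.HubbardSuperconductivity.HubbardSuperconductivity.Theorems.CwThesis.Negative.FreeEndpointFermiStep
import Summits.HubbardSuperconductivity.HubbardSuperconductivity.Theorems.CwThesis.Negative.StructureAndWindow
import Summits.HubbardSuperconductivity.HubbardSuperconductivity.Theorems.CwThesis.Negative.UniformFloor

/-!
# Crux `CwThesis` (item `stmt-HubbardSuperconductivity-10438`): the `U = 0` endpoint, unconditionally

Corollaries of the free-endpoint bound `free_pairIntensity_le` (file `FreeEndpointFermiStep.lean`) through the
`_of_freeBound` lemmas of `StructureAndWindow.lean` (standing disprover, generation 1):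

* `not_hasDWavePairFieldLROAt_zero` — at `U = 0` the summit's matrix FAILS for every doping `δ ≥ 0` (every
  normalised sector ground state of the free torus has pair intensity `≤ 320 L²`, while pair-field LRO of every
  admissible sequence forces a uniform floor `a L⁴`);
* `not_exists_doping_at_zero` — in particular no `δ ∈ (0, 1/2)` carries the matrix at `U = 0`: the summit
  with `0 < U` weakened to `0 ≤ U` would be refuted by `U := 0` only in the sense that `U = 0` is no witness;
* `cwThesis_false_from_zero` — the variant of `CwThesis` with `U ∈ [0, U₀)` is FALSE: the hypothesis `0 < U`
  of the crux is load-bearing;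
* `cwThesis_false_uniformFloor` — the strengthening of `CwThesis` with floor constant AND finite-size threshold
  uniform in `U` is FALSE (`UniformFloor.lean`): the constants of any proof must degenerate as `U → 0⁺`.

Folklore; no definitions; nothing asserts a Theses declaration.
-/

noncomputable section

namespace Summit.HubbardSuperconductivity.CwThesis.Negative

open Literature.MathematicalPhysics.QuantumLattice Literature.Barriers.HubbardSuperconductivity
open Set Matrix

/-- **No `d`-wave pair order at `U = 0`**: the summit matrix fails at the free point for every `δ ≥ 0`. [folklore] -/
theorem not_hasDWavePairFieldLROAt_zero {δ : ℝ} (hδ : 0 ≤ δ) : ¬ HasDWavePairFieldLROAt 0 δ :=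
  not_hasDWavePairFieldLROAt_zero_of_freeBound (C := 320)
    (fun _ _ hL n ψ hψ hψ1 => free_pairIntensity_le hL n ψ hψ hψ1) hδ

/-- No doping of the summit's range carries the matrix at `U = 0`. [folklore] -/
theorem not_exists_doping_at_zero : ¬ ∃ δ ∈ Ioo (0:ℝ) (1 / 2), HasDWavePairFieldLROAt 0 δ := by
  rintro ⟨δ, hδ, h⟩
  exact not_hasDWavePairFieldLROAt_zero hδ.1.le h

/-- **`CwThesisFromZero` is false**: `∃ U₀ > 0, ∀ U ∈ [0, U₀), ∃ δ ∈ [3/10, 12/25], matrix` fails — the crux's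
hypothesis `0 < U` is load-bearing. [folklore] -/
theorem cwThesis_false_from_zero :
    ¬ ∃ U₀ : ℝ, 0 < U₀ ∧ ∀ U ∈ Ico (0:ℝ) U₀, ∃ δ ∈ Icc (3/10 : ℝ) (12/25),
        HasDWavePairFieldLROAt U δ :=
  cwThesis_false_from_zero_of_freeBound (C := 320)
    (fun _ _ hL n ψ hψ hψ1 => free_pairIntensity_le hL n ψ hψ hψ1)


/-- **`CwThesisUniformFloor` is false**: no `U₀, a, k₀` give, for every `U ∈ (0,U₀)`, a doping of the window whose
floor `a L⁴ ≤ re⟨ψ, P†P ψ⟩` holds for all normalised sector ground states at all even sides `2k+2 ≥ 2k₀+2`.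
(`CwThesis` is this with `a, k₀` depending on `U`, by `cwThesis_iff_floor`.) [folklore] -/
theorem cwThesis_false_uniformFloor :
    ¬ ∃ U₀ a : ℝ, ∃ k₀ : ℕ, 0 < U₀ ∧ 0 < a ∧ ∀ U ∈ Ioo (0:ℝ) U₀, ∃ δ ∈ Icc (3/10 : ℝ) (12/25),
        ∀ k : ℕ, k₀ ≤ k → ∀ ψ : Fock (Orb (FermionTorus 2 (2 * k + 1 + 1))),
          IsGroundStateInSector (hubbardTorus 2 (2 * k + 1 + 1) 1 U)
              (2 * ⌊(1 - δ) * (((2 * k + 1 + 1 : ℕ) : ℝ)) ^ 2 / 2⌋₊) 0 ψ →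
            star ψ ⬝ᵥ ψ = 1 →
              a * ((2 * k + 1 + 1 : ℕ) : ℝ) ^ 4 ≤
                (expect ((pairField dWaveFormFactor (2 * k + 1 + 1))ᴴ *
                  pairField dWaveFormFactor (2 * k + 1 + 1)) ψ).re :=
  cwThesis_false_uniformFloor_of_freeBound (C := 320)
    (fun _ _ hL n ψ hψ hψ1 => free_pairIntensity_le hL n ψ hψ hψ1)

end Summit.HubbardSuperconductivity.CwThesis.Negative

end
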